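import Literature.NumberTheory.EllipticCurves.HeegnerPointsOfConductorRationalityProofs
import Literature.NumberTheory.EllipticCurves.HeegnerPointsRationalityGeneralLevelProofs
import Mathlib.FieldTheory.Fixed
import HarnessLib

/-!
# Route `ErratumRoadFive`, crux `EulerHalfNotRamNoInertSetAtFive` (item stmt-BirchSwinnertonDyer-19715),
# crux idea `ramified-twin-ram-transport`: THE KOLYVAGIN TOWER `y(n) ∈ E′(K[n])` EXISTS IN THE
# RAMIFIED FRAME — Heegner points of conductor `n` on `X₀(N)` are `K[n]`-rational WITHOUT `gcd(N, d_K) = 1`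

Cell `bsd-stepL`, seat `bsd-line-er5-p1-w7` (width copy g9; helper for item 19715, nothing asserted
about BSD; the crux stays OPEN). HONEST FRAMING: theorems only (no `def`, no new named fact).

Why (falsifier-desk memo `SIGN-AND-FRAME-CHECK-w7g9.md` §4, rows #1/#1′): the S1b Kolyvagin chain of
v17 consumes the level data `KolyvaginHeegnerData Dt β ι n` (Gross 1991 §§3–4), which the tree
produces (`Theorems/KolyvaginRoadThreeLevelData.lean`, `nonempty_kolyvaginHeegnerData_of_grossCM`)
from the named fact `phi_heegnerPointOfConductor_mem_range_map_ringClassField N W K` — itself PROVED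
(`…_holds`, `HeegnerPointsOfConductorRationalityProofs.lean`) but STATED under Gross's standing
hypothesis `SatisfiesHeegnerHypothesis N K` (every prime of `N` split), whose proof uses
`gcd(N, d_K) = 1` (`SatisfiesHeegnerHypothesis.coprime_discr`) in the lattice sandwich of
`levelTransport_self_of_apply_formJ_eq`. In the ramified-twin frame (`E′ = E_q` of conductor `qN′`,
`K` ramified at `q`) that hypothesis is false. But the tree already runs the sandwich under the weaker
Bezout identity `uN + vβ + wc = 1`, `4Nc = β² − D` (`HeegnerPointsLevelTransportOrders.lean`), and for
the FUNDAMENTAL `d_K` the identity is automatic for every orientation `β`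
(`exists_bezout_of_dvd_sq_sub_discr`, `HeegnerPointsRationalityGeneralLevelProofs.lean` — used there
at conductor `1`). This file carries that observation to conductor `n` prime to `N`
(`(nβ)² − n²d_K = 4N·(n²c)` and `gcd(N, nβ, n²c) = 1` from `gcd(N, β, c) = gcd(N, n) = 1`):

* `exists_bezout_conductor` — the Bezout identity at conductor `n`;
* `levelTransport_self_of_fix_ringClassField_bezout` — every `σ ∈ Aut(ℂ/K[n])` fixes the level-`N`
  structure of `x(n)`, for EVERY imaginary quadratic `K` and orientation `β` (no hypothesis on the
  primes of `N`);
* `exists_point_map_eq_heegnerPointComplexOfConductor` — **`y(n) = φ(x(n))` is the image of a point of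
  `E(K[n])`** (Gross 1991 §3 / Darmon Thm. 3.6 at conductor `n`, the CONCLUSION of the named fact
  `phi_heegnerPointOfConductor_mem_range_map_ringClassField` with `SatisfiesHeegnerHypothesis`
  DROPPED; only `4N ∣ β² − d_K`, `n ≠ 0`, `gcd(n, N) = 1`);
* `nonempty_kolyvaginHeegnerData_of_coprime` — **the level data of Gross §§3–4 exist** at every
  square-free `n` prime to `N` with inert prime factors, modulo the ONE `K`-only named fact
  `exists_generator_ringClassGalOver K` (Gross §3: `G_ℓ` cyclic) — the twin of
  `nonempty_kolyvaginHeegnerData_of_grossCM` without `SatisfiesHeegnerHypothesis`.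

So in the ramified-twin frame, where an orientation exists because `q ∥ N_{E_q}` (Cai–Shu–Tian's
condition (1); tree `Quadratic.exists_dvd_sq_sub_discr_of_split_or_dvd`), the Heegner tower of `E_q`
over `K` is available to a Kolyvagin argument exactly as on `X₀(N)` with all primes split.

References: Gross 1984 §I.1 (Heegner points `(𝒪, 𝔫, [𝔞])`, `p ∥ N` may ramify); Gross 1991 §3
(pp. 238–239); Darmon 2004 Thm. 3.6; Cox 2013 Thm. 11.1, §7.B; Kohen–Pacetti 2017 §1.
-/

noncomputable section

open scoped Classical
open scoped Cardinal

universe u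

open WeierstrassCurve NumberField Literature.NumberTheory.EllipticCurves
  Literature.NumberTheory.EllipticCurves.ModularForms
  Literature.NumberTheory.QuadraticFields.BinaryQuadraticForm
  Literature.FieldTheory.AlgClosed Cardinal

-- D-0017 layout: summit = sub-problem, so `Summit.BirchSwinnertonDyer.BirchSwinnertonDyer.…` is the
-- mandated namespace (same option as the route's sockets files).
set_option linter.dupNamespace false
set_option autoImplicit false

namespace Summit.BirchSwinnertonDyer.BirchSwinnertonDyer.Theorems.RamifiedTwinGenusHeegner

/-! ## §1 Arithmetic: the Bezout identity at conductor `n` -/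

/-- `√(m²D) = m√D` for the normalised square roots `sqrtDisc`. [folklore] -/
theorem sqrtDisc_conductor_sq_mul (D : ℤ) (m : ℕ) :
    sqrtDisc ((m : ℤ) ^ 2 * D) = (m : ℂ) * sqrtDisc D := by
  unfold sqrtDisc
  have hm : (0 : ℝ) ≤ m := Nat.cast_nonneg m
  have h : -(((m : ℤ) ^ 2 * D : ℤ) : ℝ) = (m : ℝ) ^ 2 * (-(D : ℝ)) := by push_cast; ring
  rw [h, Real.sqrt_mul (sq_nonneg _), Real.sqrt_sq hm]
  push_cast
  ring

/-- **The Bezout identity of the level-`N` structure at conductor `n`.** For `K` quadratic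
(`d_K` fundamental), `4N ∣ β² − d_K` and `gcd(n, N) = 1`: with `4Nc = β² − d_K` one has
`4N·(n²c) = (nβ)² − n²d_K` and `uN + v(nβ) + w(n²c) = 1` for some `u, v, w` — from
`u₀N + v₀β + w₀c = 1` (`exists_bezout_of_dvd_sq_sub_discr`: no prime divides `N, β, c`, else its square
divides `d_K`) and `aN + bn² = 1`. (Gross 1984 §I.1: `𝔫 ∩ 𝒪_n` is a proper `𝒪_n`-ideal of norm `N`.)
[cite: Gross1984, §I.1] [cite: GrossLMS1991, §3 (p. 238: 𝒪_n/𝒩_n ≃ ℤ/Nℤ)] -/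
theorem exists_bezout_conductor {K : Type u} [Field K] [NumberField K] (h2 : Module.finrank ℚ K = 2)
    {N : ℕ} {β : ℤ} (hβD : (4 * N : ℤ) ∣ β ^ 2 - NumberField.discr K) {n : ℕ}
    (hcop : Nat.Coprime n N) :
    ∃ c u v w : ℤ, 4 * N * c = ((n : ℤ) * β) ^ 2 - (n : ℤ) ^ 2 * NumberField.discr K ∧
      u * N + v * ((n : ℤ) * β) + w * c = 1 := by
  obtain ⟨c₀, u₀, v₀, w₀, hc₀, h₀⟩ := exists_bezout_of_dvd_sq_sub_discr h2 hβD
  obtain ⟨a, b, hab⟩ : IsCoprime ((n : ℤ) ^ 2) (N : ℤ) :=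
    (Nat.isCoprime_iff_coprime.mpr hcop).pow_left
  refine ⟨(n : ℤ) ^ 2 * c₀, a * (n : ℤ) ^ 2 * u₀ + b, a * (n : ℤ) * v₀, a * w₀, ?_, ?_⟩
  · linear_combination (n : ℤ) ^ 2 * hc₀
  · linear_combination (a * (n : ℤ) ^ 2) * h₀ + hab

/-! ## §2 Shimura reciprocity at `x(n)` without `gcd(N, d_K) = 1` -/

section Transport

variable {K : Type u} [Field K] [NumberField K]

/-- **Every `σ ∈ Aut(ℂ/K[n])` fixes the Heegner point `x(n)` of `Y₀(N)`** (`LevelTransport N σ x(n) x(n)`),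
for EVERY imaginary quadratic `K`, every orientation `β` (`4N ∣ β² − d_K`) and every `n ≠ 0` prime to
`N` — the twin of the tree's `levelTransport_self_of_fix_ringClassField` with `gcd(N, d_K) = 1`
replaced by the automatic Bezout identity (`exists_bezout_conductor`) and the sandwich engine of
`HeegnerPointsLevelTransportOrders` (`levelTransport_self_of_apply_formJ_eq_bezout`): `σ` fixes
`ι(K)` hence `n√d_K`, and fixes `j(x(n)) ∈ K[n]` (`kleinJ_heegnerPointOfConductor_mem_ringClassField`).
[cite: GrossLMS1991, §3 (x_n rational over K_n)] [cite: Darmon2004, Thm. 3.6 (PDF p. 43)]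
[cite: Gross1984, §I.1] -/
theorem levelTransport_self_of_fix_ringClassField_bezout (hK : IsImaginaryQuadratic K) (ι : K →+* ℂ)
    {N : ℕ} [NeZero N] {β : ℤ} (hβ : (4 * N : ℤ) ∣ β ^ 2 - NumberField.discr K) {m : ℕ}
    (hm : m ≠ 0) (hNm : Nat.Coprime m N) {σ : ℂ ≃+* ℂ}
    (hσ : ∀ x ∈ ringClassField K ι m, σ x = x) :
    LevelTransport N σ (heegnerPointOfConductor (NumberField.discr K) β m)
      (heegnerPointOfConductor (NumberField.discr K) β m) := by
  set D : ℤ := NumberField.discr K with hDdef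
  have hD : D < 0 := hK.discr_neg
  have hm0 : (0 : ℤ) < m := by exact_mod_cast Nat.pos_of_ne_zero hm
  have hDm : (m : ℤ) ^ 2 * D < 0 := mul_neg_of_pos_of_neg (pow_pos hm0 2) hD
  obtain ⟨hQ, hQβ⟩ := heegnerFormOfConductor_mem_heegnerForms (N := N) hD hβ hm
  obtain ⟨c, u, v, w, hc, huvw⟩ := exists_bezout_conductor hK.1 hβ hNm
  have hσK : ∀ k : K, σ (ι k) = ι k := fun k => hσ _ (apply_mem_ringClassField ι m k)
  have hsqrt : σ (sqrtDisc ((m : ℤ) ^ 2 * D)) = sqrtDisc ((m : ℤ) ^ 2 * D) := by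
    rw [sqrtDisc_conductor_sq_mul, map_mul, map_natCast, apply_sqrtDisc_discr_eq hK ι hσK]
  have hj : σ (formJ (heegnerFormOfConductor D β m)) = formJ (heegnerFormOfConductor D β m) := by
    rw [formJ_eq_kleinJ]
    exact hσ _ (kleinJ_heegnerPointOfConductor_mem_ringClassField hK ι hβ hm)
  exact levelTransport_self_of_apply_formJ_eq_bezout hDm hc huvw hsqrt hQ hQβ hj

/-- `K[n]` is countable (`K[n]/K` finite for `n ≠ 0`). [folklore] -/
theorem cardinalMk_ringClassField_le (hK : IsImaginaryQuadratic K) (ι : K →+* ℂ) {n : ℕ}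
    (hn : n ≠ 0) : #(ringClassField K ι n) ≤ ℵ₀ := by
  haveI := (finiteDimensional_and_isGalois_ringClassField hK ι hn).1
  haveI : FiniteDimensional ℚ (ringClassField K ι n) := Module.Finite.trans K (ringClassField K ι n)
  haveI : Algebra.IsAlgebraic ℚ (ringClassField K ι n) := Algebra.IsAlgebraic.of_finite ℚ _
  exact Subfield.cardinalMk_le_aleph0_of_isAlgebraic _

end Transport

/-! ## §3 `y(n) ∈ E(K[n])` and the level data, for every imaginary quadratic `K` -/

/-- **Gross 1991 §3 / Darmon Thm. 3.6 at conductor `n`, WITHOUT the Heegner hypothesis.** For `E/ℚ`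
elliptic (model `W`), ANY imaginary quadratic `K`, every modular parametrisation datum `Dt` at level
`N`, every orientation `β` (`4N ∣ β² − d_K`), every embedding `ι : K → ℂ` and every `n ≠ 0` prime to
`N`, the complex point `y(n) = φ(x(n))` (`heegnerPointComplexOfConductor Dt d_K β n`) is the image under
`K[n] ⊂ ℂ` of a point of `E(K[n])` — the conclusion of the named fact
`phi_heegnerPointOfConductor_mem_range_map_ringClassField N W K` with its standing hypothesis
`SatisfiesHeegnerHypothesis N K` dropped (the orientation `β` is the only arithmetic input; it exists
iff every prime of `N` splits or is ramified with `ℓ ∥ N`, Gross 1984 §I.1). Proof: the tree's proof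
of `…_holds` verbatim with `levelTransport_self_of_fix_ringClassField_bezout`.
[cite: GrossLMS1991, §3 (p. 238: x_n rational over K_n; y_n = φ(x_n) ∈ E(K_n))]
[cite: Darmon2004, Thm. 3.6 (PDF pp. 43–44)] [cite: Gross1984, §I.1] -/
theorem exists_point_map_eq_heegnerPointComplexOfConductor (N : ℕ) [NeZero N]
    (W : WeierstrassCurve ℚ) [W.IsElliptic] (K : Type u) [Field K] [NumberField K]
    (hK : IsImaginaryQuadratic K) (Dt : ModularParametrizationData W N) (β : ℤ) (ι : K →+* ℂ)
    (n : ℕ) (hβ : (4 * (N : ℤ)) ∣ β ^ 2 - NumberField.discr K) (hn : n ≠ 0)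
    (hcop : Nat.Coprime n N) :
    ∃ P : (W.baseChange (ringClassField K ι n)).toAffine.Point,
      WeierstrassCurve.Affine.Point.map (ringClassField K ι n).subtype.toRatAlgHom P =
        heegnerPointComplexOfConductor Dt (NumberField.discr K) β n := by
  set F := ringClassField K ι n with hF_def
  have hn0 : (0 : ℤ) < n := by exact_mod_cast Nat.pos_of_ne_zero hn
  have hDn : (n : ℤ) ^ 2 * NumberField.discr K < 0 := mul_neg_of_pos_of_neg (pow_pos hn0 2) hK.discr_neg
  obtain ⟨hQ, -⟩ := heegnerFormOfConductor_mem_heegnerForms (N := N) hK.discr_neg hβ hn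
  have hφ : Dt.IsAutEquivariantOnHeegner ((n : ℤ) ^ 2 * NumberField.discr K) :=
    Dt.isAutEquivariantOnHeegner _
  -- every `σ ∈ Aut(ℂ/K[n])` fixes `φ(x(n))`
  have hfix : ∀ σ : ℂ ≃+* ℂ, (∀ x ∈ F, σ x = x) →
      WeierstrassCurve.Affine.Point.map (σ : ℂ →+* ℂ).toRatAlgHom
          (heegnerPointComplexOfConductor Dt (NumberField.discr K) β n) =
        heegnerPointComplexOfConductor Dt (NumberField.discr K) β n := by
    intro σ hσ
    have hσK : ∀ k : K, σ (ι k) = ι k := fun k => hσ _ (apply_mem_ringClassField ι n k)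
    have hsqrt : σ (sqrtDisc ((n : ℤ) ^ 2 * NumberField.discr K)) =
        sqrtDisc ((n : ℤ) ^ 2 * NumberField.discr K) := by
      rw [sqrtDisc_conductor_sq_mul, map_mul, map_natCast, apply_sqrtDisc_discr_eq hK ι hσK]
    exact hφ σ hsqrt hQ hQ
      (levelTransport_self_of_fix_ringClassField_bezout hK ι hβ hn hcop hσ)
  have hFc : #F ≤ ℵ₀ := cardinalMk_ringClassField_le hK ι hn
  rcases hP₀ : heegnerPointComplexOfConductor Dt (NumberField.discr K) β n with _ | ⟨x, y, hxy⟩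
  · exact ⟨0, rfl⟩
  · have hcoord : ∀ σ : ℂ ≃+* ℂ, (∀ z ∈ F, σ z = z) → σ x = x ∧ σ y = y := by
      intro σ hσ
      have h := hfix σ hσ
      rw [hP₀, WeierstrassCurve.Affine.Point.map_some] at h
      have h12 := WeierstrassCurve.Affine.Point.some.inj h
      exact ⟨h12.1, h12.2⟩
    have hx : x ∈ F := Complex.mem_subfield_of_forall_ringEquiv F hFc fun σ hσ ↦ (hcoord σ hσ).1
    have hy : y ∈ F := Complex.mem_subfield_of_forall_ringEquiv F hFc fun σ hσ ↦ (hcoord σ hσ).2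
    have h₀ : (W.baseChange F).toAffine.Nonsingular ⟨x, hx⟩ ⟨y, hy⟩ :=
      (WeierstrassCurve.Affine.baseChange_nonsingular W (f := F.subtype.toRatAlgHom)
        F.subtype.injective ⟨x, hx⟩ ⟨y, hy⟩).mp hxy
    exact ⟨.some ⟨x, hx⟩ ⟨y, hy⟩ h₀, rfl⟩

/-- **The Gross §§3–4 level data `KolyvaginHeegnerData Dt β ι n` exist for EVERY imaginary quadratic
`K`** — at every square-free `n` prime to `N` whose prime factors are inert in `K`, for every datum
`Dt` at level `N`, orientation `β` and embedding `ι` — modulo the one `K`-only named fact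
`exists_generator_ringClassGalOver K` (Gross §3: `G_ℓ = Gal(K[n]/K[n/ℓ])` cyclic). Twin of
`nonempty_kolyvaginHeegnerData_of_grossCM` (`Theorems/KolyvaginRoadThreeLevelData.lean`) with the
first named fact and `SatisfiesHeegnerHypothesis N K` replaced by
`exists_point_map_eq_heegnerPointComplexOfConductor` and `gcd(n, N) = 1`; the transversal `S` and the
embedding `K[n] → K̄` are pure algebra, verbatim.
[cite: GrossLMS1991, §3 (pp. 238–239) and §4 (4.1)] [cite: Gross1984, §I.1] -/
theorem nonempty_kolyvaginHeegnerData_of_coprime {K : Type u} [Field K] [NumberField K] {N : ℕ}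
    [NeZero N] {W : WeierstrassCurve ℚ} [W.IsElliptic]
    (h2 : exists_generator_ringClassGalOver K) (hK : IsImaginaryQuadratic K)
    (Dt : ModularParametrizationData W N) (β : ℤ) (ι : K →+* ℂ)
    (hβ : (4 * N : ℤ) ∣ β ^ 2 - NumberField.discr K) {n : ℕ} (hn : Squarefree n)
    (hcop : Nat.Coprime n N) (hinert : ∀ q ∈ n.primeFactors, (Ideal.span {(q : 𝓞 K)}).IsPrime) :
    Nonempty (KolyvaginHeegnerData Dt β ι n) := by
  have hn0 : n ≠ 0 := hn.ne_zero
  -- `K[n]/ℚ` is finite: `Aut(K[n])` is finite and `K[n]/K` is algebraic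
  obtain ⟨hfd, -⟩ := finiteDimensional_and_isGalois_ringClassField hK ι hn0
  haveI := hfd
  haveI : FiniteDimensional ℚ (ringClassField K ι n) := Module.Finite.trans K (ringClassField K ι n)
  haveI : Algebra.IsAlgebraic K (ringClassField K ι n) := Algebra.IsAlgebraic.of_finite K _
  -- the embedding `K[n] → K̄` over `K`
  let e : ringClassField K ι n →ₐ[K] AlgebraicClosure K := IsAlgClosed.lift
  -- the point `y(n) ∈ E(K[n])` (no Heegner hypothesis)
  obtain ⟨P, hP⟩ := exists_point_map_eq_heegnerPointComplexOfConductor N W K hK Dt β ι n hβ hn0 hcop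
  -- the generators `σ_ℓ` (the named fact)
  have hgen : ∀ ℓ ∈ n.primeFactors, ∃ σ : ringClassField K ι n ≃ₐ[ℚ] ringClassField K ι n,
      Subgroup.zpowers σ = ringClassGalOver ι n (n / ℓ) := fun ℓ hℓ ↦
    h2 hK ι n ℓ hn (Nat.prime_of_mem_primeFactors hℓ) (Nat.dvd_of_mem_primeFactors hℓ) (hinert ℓ hℓ)
  choose! σ hσ using hgen
  -- the transversal `S` of `G_n = Gal(K[n]/K[1])` in `𝒢_n = Gal(K[n]/K)`
  set H := ringClassGalOver ι n 1 with hH_def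
  haveI : Finite (_ ⧸ H) := Finite.of_surjective _ (QuotientGroup.mk_surjective (s := H))
  haveI : Fintype (_ ⧸ H) := Fintype.ofFinite _
  let S : Finset (ringClassField K ι n ≃ₐ[ℚ] ringClassField K ι n) :=
    ((Finset.univ : Finset (_ ⧸ H)).image Quotient.out).filter (· ∈ ringClassGal ι n)
  refine ⟨{ dvd_sq_sub := hβ
            y := P
            map_y := hP
            σ := σ
            zpowers_σ := hσ
            S := S
            S_subset := fun s hs ↦ (Finset.mem_filter.mp hs).2
            S_transversal := ?_
            emb := e.toRingHom
            emb_apply := fun k ↦ e.commutes k }⟩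
  intro g hg
  have hHle : H ≤ ringClassGal ι n := ringClassGalOver_le_ringClassGal ι n 1
  -- the representative of the coset `gH`
  set s₀ := ((g : _ ⧸ H)).out with hs₀_def
  have hs₀H : g⁻¹ * s₀ ∈ H := QuotientGroup.eq.mp (QuotientGroup.out_eq' (g : _ ⧸ H)).symm
  have hs₀G : s₀ ∈ ringClassGal ι n := by
    have : s₀ = g * (g⁻¹ * s₀) := by group
    rw [this]
    exact Subgroup.mul_mem _ hg (hHle hs₀H)
  have hs₀S : s₀ ∈ S :=
    Finset.mem_filter.mpr ⟨Finset.mem_image.mpr ⟨(g : _ ⧸ H), Finset.mem_univ _, rfl⟩, hs₀G⟩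
  refine ⟨s₀, ⟨hs₀S, hs₀H⟩, ?_⟩
  rintro s ⟨hsS, hsH⟩
  obtain ⟨q, -, rfl⟩ := Finset.mem_image.mp (Finset.mem_filter.mp hsS).1
  have hgq : (g : _ ⧸ H) = q := by
    rw [← QuotientGroup.out_eq' q]
    exact QuotientGroup.eq.mpr hsH
  rw [hs₀_def, hgq]

end Summit.BirchSwinnertonDyer.BirchSwinnertonDyer.Theorems.RamifiedTwinGenusHeegner

end
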